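import Summits.ValiantsHypothesis.ValiantsHypothesis.Theses.PolyaContinued
import Literature.Computability.AlgebraicComplexity.DeterminantalComplexityProofs
import Literature.Computability.AlgebraicComplexity.DeterminantalConormalBoundKernelAlgebra
import Literature.Computability.AlgebraicComplexity.SymmetricDetRepresentationProofs
import Summits.ValiantsHypothesis.ValiantsHypothesis.Theorems.PolyaContinuedPfaffianNormalFormCover

/-!
# `PfaffianNormalForm` (item stmt-ValiantsHypothesis-7424, route PolyaContinued) — proof

`Summit.ValiantsHypothesis.ValiantsHypothesis.Theses.PolyaContinued.PfaffianNormalForm`: there is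
a constant `c` (here `c = 12`) such that every `f ∈ ℂ[X_σ]` with an affine determinantal
representation of size `m` (`HasDetRepr f m`) is a Valiant projection of the perfect-matching
polynomial `per (X|_E)` of a PFAFFIAN bipartite graph `E ⊆ Fin m' × Fin m'` (a `±1` signing of
`X|_E` has determinant `per (X|_E)`), with `m' ≤ 2 ^ ((log₂ (m + #σ) + c) ^ c)`
(`pfaffianNormalForm_proof`, unconditional: no named fact is used).

A *ranked branching program* for `f ∈ R = k[X_σ]` is a matrix `Λ` over `R` on a finite index set
with `Λ i j ≠ 0 → r i < r j` for a rank function `r`, a matrix `G` with `(1 - Λ) G = 1` (the path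
series) and read-in/read-out vectors `v`, `w` with `vᵀ G w = f`. Steps:

* `exists_dag_of_isAffineDetRepr`: from `f = det A`, `A` an `n × n` matrix of affine linear forms
  (`n ≠ 0`), a ranked program on `GKKP2011.Vtx n` (`2n³ + 2` vertices) with affine weights, affine
  read-in and constant read-out vector — the Mahajan–Vinay 1997 branching program for `DET_n` as
  formalised in the tree (`GKKP2011.bigN`, `abpValue_eq_detPoly`; Grenet–Kaltofen–Koiran–Portier
  2011, Thm. 5), pushed along the substitution `X_{ij} ↦ A i j`;
* `exists_fold_source`: folding the read-in vector into the program (one new source vertex);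
* `exists_expand_affine`: replacing every affine arc `u → u'`, `ℓ = ℓ₀ + Σₓ ℓₓ Xₓ`, by the
  two-step paths `u → (u', x) → u'` of weights `ℓₓ`, `Xₓ` (and `ℓ₀`, `1`), so that all weights
  become single variables or constants (explicit block inverse; the affine expansion of a
  polynomial of total degree `≤ 1` is the tree's
  `DeterminantalConormal.eq_C_add_sum_of_totalDegree_le_one`);
* the sibling file `…PfaffianNormalFormCover` turns the resulting program into a Pfaffian cover on
  `Fin (#ι + 1)`; the size is `m' = (2(m+1)³ + 3)(#σ + 2) + 1 ≤ (m + #σ + 2)⁶ ≤ 2^{6(L+2)} ≤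
  2^{(L+12)^{12}}`, `L = log₂ (m + #σ)` (representation padded to size `m + 1 ≠ 0` first,
  `HasDetRepr.mono_holds`).
-/

-- single-conjunct layout: Sub = Summit, duplicated namespace component intended
set_option linter.dupNamespace false

namespace Summit.ValiantsHypothesis.ValiantsHypothesis.Theorems.PolyaContinued

open Equiv Finset MvPolynomial Matrix

/-! ## Normalising a branching program: folding the source, expanding affine arcs -/

/-- **Folding the source weights into the program.** Given a ranked weighted digraph `Λ` on `ι`
with `(1 - Λ) G = 1` and read-in/read-out vectors `src`, `snk`, the digraph on `Unit ⊕ ι` with a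
new source joined to `u` by an arc of weight `src u` has the same value, now read in at the
constant vector `e_source` (block-triangular inverse). Any property of entries holding for `0`,
the entries of `Λ` and of `src` holds for the new weights. [folklore] -/
theorem exists_fold_source {R : Type*} [CommRing R] {ι : Type} [Fintype ι] [DecidableEq ι]
    (r : ι → ℕ) (Λ G : Matrix ι ι R) (src snk : ι → R)
    (hΛr : ∀ i j, Λ i j ≠ 0 → r i < r j) (hG : (1 - Λ) * G = 1)
    (Pr : R → Prop) (h0 : Pr 0) (hΛ : ∀ i j, Pr (Λ i j)) (hsrc : ∀ u, Pr (src u)) :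
    ∃ (Λ' G' : Matrix (Unit ⊕ ι) (Unit ⊕ ι) R),
      (∀ i j, Λ' i j ≠ 0 →
        Sum.elim (fun _ => 0) (fun u => r u + 1) i < Sum.elim (fun _ => 0) (fun u => r u + 1) j) ∧
      (∀ i j, Pr (Λ' i j)) ∧ (1 - Λ') * G' = 1 ∧
      Sum.elim (fun _ => (1 : R)) 0 ⬝ᵥ (G' *ᵥ Sum.elim 0 snk) = src ⬝ᵥ (G *ᵥ snk) := by
  refine ⟨Matrix.fromBlocks 0 (Matrix.replicateRow Unit src) 0 Λ,
    Matrix.fromBlocks 1 (Matrix.replicateRow Unit (src ᵥ* G)) 0 G, ?_, ?_, ?_, ?_⟩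
  · rintro (i | i) (j | j) h
    · simp at h
    · exact Nat.succ_pos _
    · simp at h
    · simp only [Matrix.fromBlocks_apply₂₂] at h
      exact Nat.succ_lt_succ (hΛr i j h)
  · rintro (i | i) (j | j)
    · simpa using h0
    · simpa using hsrc j
    · simpa using h0
    · simpa using hΛ i j
  · have h1 : (1 : Matrix (Unit ⊕ ι) (Unit ⊕ ι) R) -
        Matrix.fromBlocks 0 (Matrix.replicateRow Unit src) 0 Λ =
        Matrix.fromBlocks 1 (-Matrix.replicateRow Unit src) 0 (1 - Λ) := by
      rw [← Matrix.fromBlocks_one, sub_eq_add_neg, Matrix.fromBlocks_neg, Matrix.fromBlocks_add,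
        neg_zero, add_zero, zero_add, neg_zero, add_zero, ← sub_eq_add_neg]
    rw [h1, Matrix.fromBlocks_multiply, ← Matrix.fromBlocks_one]
    simp only [Matrix.one_mul, Matrix.mul_zero, add_zero, Matrix.zero_mul, zero_add, hG,
      Matrix.neg_mul, ← Matrix.replicateRow_vecMul, add_neg_cancel, Matrix.mul_one]
  · rw [Matrix.fromBlocks_mulVec, Sum.elim_comp_inl, Sum.elim_comp_inr, sumElim_dotProduct_sumElim,
      zero_dotProduct, add_zero, Matrix.mulVec_zero, zero_add, Matrix.replicateRow_mulVec_eq_const,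
      Matrix.dotProduct_mulVec]
    simp [dotProduct]

/-- **Expanding affine arcs.** A ranked weighted digraph `Λ` on `ι` whose weights are affine
linear forms in the variables `σ` is replaced by one on `ι ⊕ ι × Option σ` whose weights are
single variables or constants: the arc `u → u'` of weight `ℓ = ℓ₀ + Σₓ ℓₓ Xₓ` becomes the
two-step paths `u → (u', none) → u'` of weights `ℓ₀, 1` and `u → (u', some x) → u'` of weights
`ℓₓ, Xₓ` (the middle vertices are shared among all arcs into `u'`). The value read between old
vertices is unchanged (explicit block inverse with Schur complement `1 - P Q = 1 - Λ`). [folklore] -/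
theorem exists_expand_affine {k : Type*} [CommRing k] {σ : Type*} [Fintype σ] [DecidableEq σ]
    {ι : Type*} [Fintype ι] [DecidableEq ι]
    (r : ι → ℕ) (Λ G : Matrix ι ι (MvPolynomial σ k)) (v w : ι → MvPolynomial σ k)
    (hΛr : ∀ i j, Λ i j ≠ 0 → r i < r j) (hΛa : ∀ i j, (Λ i j).totalDegree ≤ 1)
    (hG : (1 - Λ) * G = 1) :
    ∃ (r' : ι ⊕ ι × Option σ → ℕ)
      (Λ' G' : Matrix (ι ⊕ ι × Option σ) (ι ⊕ ι × Option σ) (MvPolynomial σ k)),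
      (∀ i j, Λ' i j ≠ 0 → r' i < r' j) ∧
      (∀ i j, (∃ x, Λ' i j = X x) ∨ ∃ c, Λ' i j = C c) ∧
      (1 - Λ') * G' = 1 ∧
      Sum.elim v 0 ⬝ᵥ (G' *ᵥ Sum.elim w 0) = v ⬝ᵥ (G *ᵥ w) := by
  -- the two halves of the expanded arcs
  let Pm : Matrix ι (ι × Option σ) (MvPolynomial σ k) := Matrix.of fun u q =>
    C ((Λ u q.1).coeff (Option.elim q.2 0 fun x => Finsupp.single x 1))
  let Qm : Matrix (ι × Option σ) ι (MvPolynomial σ k) := Matrix.of fun q u' =>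
    if q.1 = u' then Option.elim q.2 1 X else 0
  have hPQ : Pm * Qm = Λ := by
    refine Matrix.ext fun u u' => ?_
    rw [Matrix.mul_apply, Fintype.sum_prod_type, Finset.sum_eq_single u']
    · rw [Fintype.sum_option]
      simp only [Pm, Qm, Matrix.of_apply, ↓reduceIte, Option.elim_none, Option.elim_some, mul_one]
      exact (Literature.Computability.AlgebraicComplexity.DeterminantalConormal.eq_C_add_sum_of_totalDegree_le_one
        (hΛa u u')).symm
    · intro b _ hb
      exact Finset.sum_eq_zero fun o _ => by simp [Qm, hb]
    · intro h; exact absurd (Finset.mem_univ u') h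
  refine ⟨Sum.elim (fun u => 2 * r u + 1) (fun q => 2 * r q.1), Matrix.fromBlocks 0 Pm Qm 0,
    Matrix.fromBlocks G (G * Pm) (Qm * G) (1 + Qm * G * Pm), ?_, ?_, ?_, ?_⟩
  · rintro (u | q) (u' | q') h
    · simp at h
    · simp only [Matrix.fromBlocks_apply₁₂, Pm, Matrix.of_apply, ne_eq, C_eq_zero] at h
      have hne : Λ u q'.1 ≠ 0 := fun h0 => h (by rw [h0, coeff_zero])
      have := hΛr u q'.1 hne
      simp only [Sum.elim_inl, Sum.elim_inr]
      omega
    · simp only [Matrix.fromBlocks_apply₂₁, Qm, Matrix.of_apply, ne_eq, ite_eq_right_iff,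
        Classical.not_imp] at h
      simp only [Sum.elim_inl, Sum.elim_inr, h.1]
      omega
    · simp at h
  · rintro (u | q) (u' | q')
    · exact Or.inr ⟨0, by simp⟩
    · exact Or.inr ⟨_, rfl⟩
    · simp only [Matrix.fromBlocks_apply₂₁, Qm, Matrix.of_apply]
      by_cases hq : q.1 = u'
      · rw [if_pos hq]
        rcases q with ⟨q1, _ | x⟩
        · exact Or.inr ⟨1, by simp⟩
        · exact Or.inl ⟨x, rfl⟩
      · rw [if_neg hq]; exact Or.inr ⟨0, by simp⟩
    · exact Or.inr ⟨0, by simp⟩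
  · have hG' : G - Λ * G = 1 := by rwa [sub_mul, Matrix.one_mul] at hG
    have h1 : (1 : Matrix (ι ⊕ ι × Option σ) (ι ⊕ ι × Option σ) (MvPolynomial σ k)) -
        Matrix.fromBlocks 0 Pm Qm 0 = Matrix.fromBlocks 1 (-Pm) (-Qm) 1 := by
      rw [← Matrix.fromBlocks_one, sub_eq_add_neg, Matrix.fromBlocks_neg, Matrix.fromBlocks_add,
        neg_zero, add_zero, zero_add, zero_add, neg_zero, add_zero]
    have hkey : G * Pm - Λ * G * Pm = Pm := by rw [← Matrix.sub_mul, hG', Matrix.one_mul]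
    rw [h1, Matrix.fromBlocks_multiply, ← Matrix.fromBlocks_one]
    congr 1
    · rw [Matrix.one_mul, Matrix.neg_mul, ← Matrix.mul_assoc, hPQ, ← sub_eq_add_neg, hG']
    · rw [Matrix.one_mul, Matrix.neg_mul, Matrix.mul_add, Matrix.mul_one, ← Matrix.mul_assoc,
        ← Matrix.mul_assoc, hPQ]
      calc G * Pm + -(Pm + Λ * G * Pm) = (G * Pm - Λ * G * Pm) - Pm := by abel
        _ = 0 := by rw [hkey, sub_self]
    · rw [Matrix.neg_mul, Matrix.one_mul, neg_add_cancel]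
    · rw [Matrix.neg_mul, Matrix.one_mul, ← Matrix.mul_assoc]
      abel
  · rw [Matrix.fromBlocks_mulVec, Sum.elim_comp_inl, Sum.elim_comp_inr, sumElim_dotProduct_sumElim,
      zero_dotProduct, add_zero, Matrix.mulVec_zero, add_zero]


/-! ## The branching program of an affine determinantal representation -/

/-- **From an affine determinantal representation to a ranked branching program.** If
`f = det A` for an `n × n` matrix `A` of affine linear forms (`n ≠ 0`), substitute the entries of
`A` into the Mahajan–Vinay branching program for `DET_n` formalised in the tree
(`GKKP2011.bigN`, `srcVec`, `snkVec`, `abpValue_eq_detPoly`): the result is a layered weighted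
digraph `Λ` on `GKKP2011.Vtx n` (`2n³ + 2` vertices) with affine weights, affine source weights,
constant sink weights, `(1 - Λ) G = 1` for the mapped geometric series `G`, and value `f`.
[cite: MahajanVinay1997, §3] -/
theorem exists_dag_of_isAffineDetRepr {σ : Type*} (f : MvPolynomial σ ℂ) {n : ℕ} (hn : n ≠ 0)
    (A : Matrix (Fin n) (Fin n) (MvPolynomial σ ℂ))
    (hA : Literature.Computability.AlgebraicComplexity.IsAffineDetRepr f A) :
    ∃ (Λ G : Matrix (Literature.Computability.AlgebraicComplexity.GKKP2011.Vtx n)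
        (Literature.Computability.AlgebraicComplexity.GKKP2011.Vtx n) (MvPolynomial σ ℂ))
      (src snk : Literature.Computability.AlgebraicComplexity.GKKP2011.Vtx n → MvPolynomial σ ℂ),
      (∀ i j, Λ i j ≠ 0 →
        Literature.Computability.AlgebraicComplexity.GKKP2011.layerFn n i <
          Literature.Computability.AlgebraicComplexity.GKKP2011.layerFn n j) ∧
      (∀ i j, (Λ i j).totalDegree ≤ 1) ∧ (∀ i, (src i).totalDegree ≤ 1) ∧
      (∀ i, ∃ c, snk i = C c) ∧ (1 - Λ) * G = 1 ∧ src ⬝ᵥ (G *ᵥ snk) = f := by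
  open Literature.Computability.AlgebraicComplexity in
  open Literature.Computability.AlgebraicComplexity.GKKP2011 in
  set φ : MvPolynomial (Fin n × Fin n) ℂ →ₐ[ℂ] MvPolynomial σ ℂ :=
    aeval fun ij : Fin n × Fin n => A ij.1 ij.2 with hφ
  have hφe : ∀ y : MvPolynomial (Fin n × Fin n) ℂ, IsEntry ℂ n y → (φ y).totalDegree ≤ 1 := by
    rintro y (⟨ij, rfl⟩ | rfl | rfl | rfl | rfl)
    · rw [hφ, aeval_X]; exact hA.1 _ _
    · simp
    · simp
    · rw [map_neg, map_one, totalDegree_neg, totalDegree_one]; exact Nat.zero_le _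
    · rw [hφ, aeval_C, MvPolynomial.algebraMap_eq, totalDegree_C]; exact Nat.zero_le _
  refine ⟨-(φ.mapMatrix (bigN ℂ n)), φ.mapMatrix (geomInv (bigN ℂ n) (n + 1)),
    fun v => φ (srcVec ℂ n v), fun v => φ (snkVec ℂ n v), ?_, ?_, ?_, ?_, ?_, ?_⟩
  · intro i j h
    rw [Matrix.neg_apply, ne_eq, neg_eq_zero, AlgHom.mapMatrix_apply, Matrix.map_apply] at h
    have h' : bigN ℂ n i j ≠ 0 := fun h0 => h (by rw [h0, map_zero])
    have := bigN_isLayered i j h'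
    omega
  · intro i j
    rw [Matrix.neg_apply, totalDegree_neg, AlgHom.mapMatrix_apply, Matrix.map_apply]
    exact hφe _ (isEntry_bigN i j)
  · exact fun i => hφe _ (isEntry_srcVec i)
  · rintro (p | π)
    · exact ⟨0, by simp [snkVec]⟩
    · refine ⟨if π then -1 else 1, ?_⟩
      cases π <;> simp [snkVec, sgnB]
  · have h1 : (1 : Matrix (Vtx n) (Vtx n) (MvPolynomial σ ℂ)) + φ.mapMatrix (bigN ℂ n) =
        φ.mapMatrix (1 + bigN ℂ n) := by rw [map_add, map_one]
    rw [sub_neg_eq_add, h1, ← map_mul, one_add_mul_geomInv bigN_pow_eq_zero, map_one]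
  · have h := abpValue_eq_detPoly (k := ℂ) hn
    unfold abpValue at h
    have key : φ (srcVec ℂ n ⬝ᵥ (geomInv (bigN ℂ n) (n + 1) *ᵥ snkVec ℂ n)) =
        (fun v => φ (srcVec ℂ n v)) ⬝ᵥ
          (φ.mapMatrix (geomInv (bigN ℂ n) (n + 1)) *ᵥ fun v => φ (snkVec ℂ n v)) := by
      simp only [dotProduct, Matrix.mulVec, map_sum, map_mul, AlgHom.mapMatrix_apply,
        Matrix.map_apply]
    rw [← key, h, detPoly, AlgHom.map_det, hφ, Matrix.mvPolynomialX_mapMatrix_aeval ℂ A]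
    exact hA.2

/-! ## The item -/

/-- **`PfaffianNormalForm` (item stmt-ValiantsHypothesis-7424 of route PolyaContinued).** With
`c = 12`: every polynomial `f ∈ ℂ[X_σ]` with an affine determinantal representation of size `m`
is a projection of the perfect-matching polynomial `per (X|_E)` of a Pfaffian bipartite graph
`E` (a `±1` signing of `X|_E` has determinant `per (X|_E)`) on `m' + m'` vertices,
`m' ≤ 2 ^ ((log₂ (m + #σ) + 12) ^ 12)` — in fact `m' = (2(m+1)³ + 3)(#σ + 2) + 1`.
Proof: Mahajan–Vinay/GKKP branching program for `DET_{m+1}` with the affine entries substituted,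
source folded in, affine arcs expanded into variable/constant two-step paths, and the split graph
with a super-vertex, signed arcs `-1` / idle edges `+1`. -/
theorem pfaffianNormalForm_proof :
    Summit.ValiantsHypothesis.ValiantsHypothesis.Theses.PolyaContinued.PfaffianNormalForm := by
  open Literature.Computability.AlgebraicComplexity in
  refine ⟨12, ?_⟩
  intro σ _ f m hf
  haveI : DecidableEq σ := Classical.decEq σ
  -- build the `DecidableEq` instances of the index types step by step (direct synthesis of the
  -- largest one exceeds the instance size limit)
  letI iV : DecidableEq (GKKP2011.Vtx (m + 1)) := instDecidableEqSum
  letI i₁ : DecidableEq (Unit ⊕ GKKP2011.Vtx (m + 1)) := instDecidableEqSum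
  letI i₂ : DecidableEq ((Unit ⊕ GKKP2011.Vtx (m + 1)) × Option σ) := instDecidableEqProd
  letI i₃ : DecidableEq ((Unit ⊕ GKKP2011.Vtx (m + 1)) ⊕ (Unit ⊕ GKKP2011.Vtx (m + 1)) × Option σ) :=
    instDecidableEqSum
  -- a representation of size `n = m + 1 ≠ 0`
  obtain ⟨A, hA⟩ := HasDetRepr.mono_holds hf (show m ≤ m + 1 by omega)
  obtain ⟨Λ₀, G₀, src, snk, hr₀, hΛ₀, hsrc, hsnk, hG₀, hf₀⟩ :=
    exists_dag_of_isAffineDetRepr f (Nat.succ_ne_zero m) A hA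
  obtain ⟨Λ₁, G₁, hr₁, hΛ₁, hG₁, hf₁⟩ := exists_fold_source (GKKP2011.layerFn (m + 1)) Λ₀ G₀ src snk
    hr₀ hG₀ (fun y => y.totalDegree ≤ 1) (by simp) hΛ₀ hsrc
  -- the new read-in / read-out vectors (constants `1`, `0` / `0`, `±1`)
  set v₁ : Unit ⊕ GKKP2011.Vtx (m + 1) → MvPolynomial σ ℂ := Sum.elim (fun _ => 1) 0 with hv₁
  set w₁ : Unit ⊕ GKKP2011.Vtx (m + 1) → MvPolynomial σ ℂ := Sum.elim 0 snk with hw₁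
  obtain ⟨r₂, Λ₂, G₂, hr₂, hΛ₂, hG₂, hf₂⟩ := exists_expand_affine _ Λ₁ G₁ v₁ w₁ hr₁ hΛ₁ hG₁
  have hv : ∀ i : (Unit ⊕ GKKP2011.Vtx (m + 1)) ⊕ (Unit ⊕ GKKP2011.Vtx (m + 1)) × Option σ,
      (∃ x, Sum.elim v₁ 0 i = X x) ∨ ∃ c, Sum.elim v₁ 0 i = C c := by
    rintro ((_ | _) | _)
    · exact Or.inr ⟨1, by simp [hv₁]⟩
    · exact Or.inr ⟨0, by simp [hv₁]⟩
    · exact Or.inr ⟨0, by simp⟩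
  have hw : ∀ i : (Unit ⊕ GKKP2011.Vtx (m + 1)) ⊕ (Unit ⊕ GKKP2011.Vtx (m + 1)) × Option σ,
      (∃ x, Sum.elim w₁ 0 i = X x) ∨ ∃ c, Sum.elim w₁ 0 i = C c := by
    rintro ((_ | u) | _)
    · exact Or.inr ⟨0, by simp [hw₁]⟩
    · obtain ⟨c, hc⟩ := hsnk u
      exact Or.inr ⟨c, by simpa [hw₁] using hc⟩
    · exact Or.inr ⟨0, by simp⟩
  obtain ⟨E, P, hP, hs, hproj⟩ := exists_pfaffianCover_of_ranked r₂ Λ₂ G₂ _ _ f hr₂ hΛ₂ hv hw hG₂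
    (by rw [hf₂, hf₁, hf₀])
  refine ⟨_, ?_, E, P, hP, hs, hproj⟩
  -- the size bound: `(2 n³ + 3)(#σ + 2) + 1 ≤ T⁶ ≤ 2^(6(L+2)) ≤ 2^((L+12)^12)`,
  -- `T = m + #σ + 2 ≤ 2^(L+2)`, `L = log₂ (m + #σ)`
  simp only [Fintype.card_sum, Fintype.card_prod, Fintype.card_option, Fintype.card_unit,
    Fintype.card_fin, Fintype.card_bool]
  set s := Fintype.card σ with hs_def
  set L := Nat.log 2 (m + s) with hL
  set T := m + s + 2 with hT
  have hT2 : 2 ≤ T := by omega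
  have hn : m + 1 ≤ T := by omega
  have hn3 : (m + 1) ^ 3 ≤ T ^ 3 := Nat.pow_le_pow_left hn 3
  have h8 : 8 ≤ T ^ 3 := by
    calc 8 = 2 ^ 3 := by norm_num
      _ ≤ T ^ 3 := Nat.pow_le_pow_left hT2 3
  have hN : 1 + ((m + 1) * ((m + 1) * (m + 1) * 2) + 2) ≤ 3 * T ^ 3 := by
    have : (m + 1) * ((m + 1) * (m + 1) * 2) = 2 * (m + 1) ^ 3 := by ring
    rw [this]
    omega
  have hsT : s + 1 + 1 ≤ T := by omega
  have hlhs : 1 + ((m + 1) * ((m + 1) * (m + 1) * 2) + 2) +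
      (1 + ((m + 1) * ((m + 1) * (m + 1) * 2) + 2)) * (s + 1) + 1 ≤ T ^ 6 := by
    have h1 : 1 + ((m + 1) * ((m + 1) * (m + 1) * 2) + 2) +
        (1 + ((m + 1) * ((m + 1) * (m + 1) * 2) + 2)) * (s + 1) =
        (1 + ((m + 1) * ((m + 1) * (m + 1) * 2) + 2)) * (s + 1 + 1) := by ring
    rw [h1]
    have h2 : (1 + ((m + 1) * ((m + 1) * (m + 1) * 2) + 2)) * (s + 1 + 1) ≤ 3 * T ^ 3 * T :=
      Nat.mul_le_mul hN hsT
    have h3 : 1 ≤ T ^ 4 := Nat.one_le_pow _ _ (by omega)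
    have h4 : 4 ≤ T ^ 2 := by
      calc 4 = 2 ^ 2 := by norm_num
        _ ≤ T ^ 2 := Nat.pow_le_pow_left hT2 2
    calc (1 + ((m + 1) * ((m + 1) * (m + 1) * 2) + 2)) * (s + 1 + 1) + 1
        ≤ 3 * T ^ 3 * T + T ^ 4 := Nat.add_le_add h2 h3
      _ = 4 * T ^ 4 := by ring
      _ ≤ T ^ 2 * T ^ 4 := Nat.mul_le_mul_right _ h4
      _ = T ^ 6 := by ring
  have hTL : T ≤ 2 ^ (L + 2) := by
    have h : m + s < 2 ^ (L + 1) := by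
      rw [hL]; exact Nat.lt_pow_succ_log_self Nat.one_lt_two (m + s)
    have h1 : 1 ≤ 2 ^ (L + 1) := Nat.one_le_two_pow
    calc T = m + s + 2 := hT
      _ ≤ 2 ^ (L + 1) + 2 ^ (L + 1) := by omega
      _ = 2 ^ (L + 2) := by ring
  have hexp : 6 * (L + 2) ≤ (L + 12) ^ 12 := by
    calc 6 * (L + 2) ≤ (L + 12) ^ 2 := by nlinarith
      _ ≤ (L + 12) ^ 12 := Nat.pow_le_pow_right (by omega) (by norm_num)
  calc 1 + ((m + 1) * ((m + 1) * (m + 1) * 2) + 2) +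
        (1 + ((m + 1) * ((m + 1) * (m + 1) * 2) + 2)) * (s + 1) + 1
      ≤ T ^ 6 := hlhs
    _ ≤ (2 ^ (L + 2)) ^ 6 := Nat.pow_le_pow_left hTL 6
    _ = 2 ^ (6 * (L + 2)) := by rw [← pow_mul, Nat.mul_comm]
    _ ≤ 2 ^ ((L + 12) ^ 12) := Nat.pow_le_pow_right Nat.two_pos hexp

end Summit.ValiantsHypothesis.ValiantsHypothesis.Theorems.PolyaContinued
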